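import Summits.MatrixMultiplication.OmegaCensus.SmallFormats.MatMul22nRankGF7Classes
import Summits.MatrixMultiplication.OmegaCensus.SmallFormats.MatMul22nRankGF5ThreeNPlusTwo
import HarnessLib

/-!
# ω-census family (a): `R_𝔽₇(⟨2,2,n⟩) ≥ 3n + 2` for `n ≥ 8` (Alekseev's any-field value, kernel over `𝔽₇`)

Cell `pub-omega` (unit `pub-omega-tensor-g7`), topic `Summits/MatrixMultiplication/OmegaCensus` (sub-folder
`SmallFormats`). Framing (verbatim): lottery ticket; floor = certified bounds/negative ranges. HONEST FRAMING: the VALUE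
`R(⟨2,2,n⟩) ≥ 3n + 2` (`n ≥ 3`) over every field is PRINTED — Alekseev 2014/2015 (tree: the NAMED FACT
`alekseev2015_rank_matMulTensor_m22_ge`). New for the census: an UNCONDITIONAL kernel proof over `𝔽₇` for every `n ≥ 8`
(for `n ≥ 18` the tree's counting theorem `51·R ≥ 156·n`, `MatMul22nRankFiniteField.lean`, already gives it; the cells
gained are `n = 8, …, 17`). This is the `𝔽₇` twin of `MatMul22nRankGF5ThreeNPlusTwo.lean` (`𝔽₅`, `n ≥ 6`): same sandwich
normalisations (imported from there), with the `𝔽₇` clique certificate `seven7_ok` of `MatMul22nRankGF7Classes.lean`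
(clique number `8` instead of `5`) and `8` row planes instead of `6`. Nothing here is progress on `ω`.

THE ARGUMENT at `r ≤ 3n + 1` over `𝔽₇` (`z / a / b` = zero / rank-one / invertible X-forms): every dual-type and every
`𝔽₄₉`-type plane is annihilated by at most one form (`pair_false_gf7`), so the invertible forms lie in pairwise uncapped
classes, of which there are at most `8` (`no_nine_gf7`: normalise the first form to `I`, the second to a multiple of
`diag(1, β+2)`, the other seven are listed and two of any seven listed classes are capped, or two of them coincide); the `8`
row planes carry at most `2r − 6n ≤ 2` forms each, so `8z + a ≤ 16`; hence `r ≤ 24 < 25 ≤ 3n + 1` for `n ≥ 8`.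
-/

namespace Summit.MatrixMultiplication.OmegaCensus.SmallFormats

open Module Matrix Literature.Computability.AlgebraicComplexity
open Summit.MatrixMultiplication.OmegaCensus.RankOnePlaneCapGeneral

section GF7

/-- **Two distinct products never annihilate a common dual-type / `𝔽₄₉`-type plane** when `|ι| ≤ 3n + 1` (over `𝔽₇`). -/
theorem pair_false_gf7 {n : ℕ} {ι : Type*} [Fintype ι] [DecidableEq ι] (hι : Fintype.card ι ≤ 3 * n + 1)
    (β : BilinComp (mulBilin (ZMod 7) 2 2 n) ι) (u : ι → Fin 2 × Fin 2 → ZMod 7)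
    (hA : ∀ i x, β.f i x = dotX (u i) x) {i i' : ι} (hii : i ≠ i') {w : ℕ}
    (hi : okW7 (u i) w = true) (hi' : okW7 (u i') w = true) : False := by
  classical
  rcases common_of_okW7 hi hi' with ⟨l, h1, h2⟩ | ⟨l, h1, h2⟩
  · have h := (jPlane7 l).three_mul_add_card_le β u hA (fun t => perpJ7 (u t) l = true) (fun t ht => perpJ7_dotX ht)
    have h2' : 1 < (Finset.univ.filter fun t => perpJ7 (u t) l = true).card :=
      Finset.one_lt_card_iff.2 ⟨i, i', by simp [h1], by simp [h2], hii⟩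
    omega
  · have h := (qPlane7 l).three_mul_add_card_le zmod7_sq_ne β u hA (fun t => perpQ7 (u t) l = true)
      (fun t ht => perpQ7_dotX ht)
    have h2' : 1 < (Finset.univ.filter fun t => perpQ7 (u t) l = true).card :=
      Finset.one_lt_card_iff.2 ⟨i, i', by simp [h1], by simp [h2], hii⟩
    omega

/-- **No nine products with invertible X-forms** when `|ι| ≤ 3n + 1` over `𝔽₇` (clique number of "uncapped" is `8`). -/
theorem no_nine_gf7 {n : ℕ} {ι : Type*} [Fintype ι] [DecidableEq ι] (hι : Fintype.card ι ≤ 3 * n + 1)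
    (β : BilinComp (mulBilin (ZMod 7) 2 2 n) ι) (u : ι → Fin 2 × Fin 2 → ZMod 7)
    (hA : ∀ i x, β.f i x = dotX (u i) x) (t : Fin 9 → ι) (ht : Function.Injective t)
    (hinv : ∀ j, det2 (u (t j)) ≠ 0) : False := by
  classical
  have hne : ∀ {j j' : Fin 9}, j ≠ j' → t j ≠ t j' := fun h e => h (ht e)
  -- first normalisation: the form of `t 0` becomes `I`
  have hdA : det2 (u (t 0)) ≠ 0 := hinv 0
  set β₁ := xSandwich β (P1 (u (t 0))) (P1' (u (t 0))) 1 1 (P1'_mul_P1 _ hdA) (Matrix.mul_one 1) with hβ₁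
  set u₁ : ι → Fin 2 × Fin 2 → ZMod 7 := fun i => sand (P1 (u (t 0))) 1 (u i) with hu₁
  have hA₁ : ∀ i x, β₁.f i x = dotX (u₁ i) x := xSandwich_dotX β u hA _ _ _ _ _ _
  have h10 : ∀ p, u₁ (t 0) p = idC7 p := sand_P1 _ hdA
  have hinv₁ : ∀ j, det2 (u₁ (t j)) ≠ 0 := by
    intro j
    show det2 (sand _ _ (u (t j))) ≠ 0
    rw [det2_sand, mdet2_one, mul_one]
    exact mul_ne_zero (mdet2_P1_ne_zero _ hdA) (hinv j)
  -- the class of the second form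
  obtain ⟨_, hrep2⟩ := repF7_spec (u₁ (t 1)) (hinv₁ 1)
  have hval2 : det2 (repF7 (code7 (u₁ (t 1)))) ≠ 0 := by
    intro h0; apply hinv₁ 1; rw [det2_of_eq_mul hrep2, h0, mul_zero]
  by_cases hI2 : wI7 (code7 (u₁ (t 1))) = 0
  swap
  · obtain ⟨w1, w2⟩ := wI7_ok _ hval2 hI2
    exact pair_false_gf7 hι β₁ u₁ hA₁ (hne (by decide)) (okW7_congr h10 w1) (okW7_of_eq_mul hrep2 w2)
  -- second normalisation: the form of `t 1` becomes a multiple of `D_β`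
  obtain ⟨hPP, hid, hdiag, _⟩ := cj7_ok _ hval2 hI2
  set c₂ := code7 (u₁ (t 1)) with hc₂
  set b := cjB7 c₂ with hb
  set β₂ := xSandwich β₁ (cjP7 c₂) (cjPi7 c₂) (cjPi7 c₂) (cjP7 c₂) hPP hPP with hβ₂
  set u₂ : ι → Fin 2 × Fin 2 → ZMod 7 := fun i => sand (cjP7 c₂) (cjPi7 c₂) (u₁ i) with hu₂
  have hA₂ : ∀ i x, β₂.f i x = dotX (u₂ i) x := xSandwich_dotX β₁ u₁ hA₁ _ _ _ _ _ _
  have h20 : ∀ p, u₂ (t 0) p = idC7 p := by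
    intro p
    show sand _ _ (u₁ (t 0)) p = _
    rw [sand_congr h10]; exact hid p
  have h21 : ∀ p, u₂ (t 1) p = (lead7 (u₁ (t 1)) * cjS7 c₂) * D7 b p := by
    intro p
    show sand _ _ (u₁ (t 1)) p = _
    rw [sand_smul hrep2 p, hdiag p, mul_assoc]
  have hinv₂ : ∀ j, det2 (u₂ (t j)) ≠ 0 := by
    intro j
    show det2 (sand _ _ (u₁ (t j))) ≠ 0
    rw [det2_sand]
    exact mul_ne_zero (mul_ne_zero (mdet2_ne_zero_right hPP) (hinv₁ j)) (mdet2_ne_zero_left hPP)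
  -- the other seven forms lie in listed classes
  have hmem : ∀ j : Fin 9, j ≠ 0 → j ≠ 1 →
      ∃ p : Fin 67, ∀ q, u₂ (t j) q = lead7 (u₂ (t j)) * repF7 (nb7 b p) q := by
    intro j hj0 hj1
    obtain ⟨_, hrep⟩ := repF7_spec (u₂ (t j)) (hinv₂ j)
    have hval : det2 (repF7 (code7 (u₂ (t j)))) ≠ 0 := by
      intro h0; apply hinv₂ j; rw [det2_of_eq_mul hrep, h0, mul_zero]
    by_cases hI : wI7 (code7 (u₂ (t j))) = 0
    swap
    · obtain ⟨w1, w2⟩ := wI7_ok _ hval hI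
      exact (pair_false_gf7 hι β₂ u₂ hA₂ (hne hj0.symm) (okW7_congr h20 w1) (okW7_of_eq_mul hrep w2)).elim
    by_cases hD : wD7 b (code7 (u₂ (t j))) = 0
    swap
    · obtain ⟨w1, w2⟩ := wD7_ok b _ hval hD
      exact (pair_false_gf7 hι β₂ u₂ hA₂ (hne hj1.symm) (okW7_of_eq_mul h21 w1) (okW7_of_eq_mul hrep w2)).elim
    obtain ⟨p, hp⟩ := mem7_ok b _ hval hI hD
    exact ⟨p, fun q => by rw [hp]; exact hrep q⟩
  -- index the seven remaining forms by `Fin 7`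
  let e : Fin 7 → Fin 9 := fun m => ⟨m.val + 2, by omega⟩
  have he : Function.Injective e := fun m m' h => Fin.ext (by simpa [e] using congrArg Fin.val h)
  have he0 : ∀ m, e m ≠ 0 := fun m h => by simpa [e] using congrArg Fin.val h
  have he1 : ∀ m, e m ≠ 1 := fun m h => by have := congrArg Fin.val h; simp [e] at this
  choose g hg using fun m : Fin 7 => hmem (e m) (he0 m) (he1 m)
  -- a capped pair among the seven listed classes
  have hpair : ∀ {m m' : Fin 7}, m ≠ m' → wN7 b (g m) (g m') ≠ 0 → False := by
    intro m m' hmm hw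
    obtain ⟨w1, w2⟩ := wN7_ok b (g m) (g m') hw
    exact pair_false_gf7 hι β₂ u₂ hA₂ (hne fun h => hmm (he h)) (okW7_of_eq_mul (hg m) w1) (okW7_of_eq_mul (hg m') w2)
  by_cases hginj : Function.Injective g
  · set S : Finset (Fin 67) := Finset.univ.image g with hS
    have hcard : S.card = 7 := by rw [hS, Finset.card_image_of_injective _ hginj, Finset.card_univ, Fintype.card_fin]
    obtain ⟨p, hp, p', hp', hpp, hw⟩ := seven7_ok b S hcard
    obtain ⟨m, -, rfl⟩ := Finset.mem_image.1 hp
    obtain ⟨m', -, rfl⟩ := Finset.mem_image.1 hp'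
    exact hpair (fun h => (ne_of_lt hpp) (by rw [h])) hw
  · obtain ⟨m, m', hgm, hmm⟩ : ∃ m m', g m = g m' ∧ m ≠ m' := by
      simpa [Function.Injective] using hginj
    refine hpair hmm ?_
    rw [hgm]; exact wN7_diag b (g m')

/-! ## The counting -/

/-- **The counting at `r ≤ 3n + 1` over `𝔽₇`**: a decomposition of `⟨2,2,n⟩` over `𝔽₇` into `r ≤ 3n + 1` triads has
`r ≤ 24` (`8z + a ≤ 16` by the eight row planes, `b ≤ 8` by `no_nine_gf7`). -/
theorem card_le_24_gf7 (n r : ℕ) (w : Fin r → Fin 2 × Fin n → ZMod 7)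
    (u : Fin r → Fin 2 × Fin 2 → ZMod 7) (v : Fin r → Fin 2 × Fin n → ZMod 7)
    (hdec : matMulTensor (ZMod 7) 2 2 n = ∑ i, triad (w i) (u i) (v i)) (hr : r ≤ 3 * n + 1) : r ≤ 24 := by
  classical
  set β := bilinCompOfTriads (ZMod 7) w u v hdec with hβ
  have hA : ∀ i x, β.f i x = dotX (u i) x := fun i x => rfl
  -- (L) the quantitative cap of each of the 8 row planes, summed
  have hRow : ∀ o : Option (ZMod 7), (Finset.univ.filter fun t => p1rep o ᵥ* xMat (u t) = 0).card + 6 * n ≤ 2 * r := by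
    intro o
    have h := card_vanishing_le_two_mul_sub (n := n) (le_refl 2) β (p1rep_ne_zero o)
      (Finset.univ.filter fun t => p1rep o ᵥ* xMat (u t) = 0)
      (fun i hi z => by
        rw [Finset.mem_filter] at hi
        rw [hA, dotX_vecMulVec_eq, hi.2, zero_dotProduct])
    simpa only [Fintype.card_fin] using h
  have hRsum : ∑ o : Option (ZMod 7), ((Finset.univ.filter fun t => p1rep o ᵥ* xMat (u t) = 0).card + 6 * n)
      ≤ ∑ _o : Option (ZMod 7), 2 * r := Finset.sum_le_sum fun o _ => hRow o
  rw [Finset.sum_add_distrib] at hRsum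
  simp only [Finset.sum_const, Finset.card_univ, smul_eq_mul] at hRsum
  have hL : ∑ i, (Fintype.card (Option (ZMod 7)) * (if u i = 0 then 1 else 0)
      + (if (u i ≠ 0 ∧ u i (0, 0) * u i (1, 1) - u i (0, 1) * u i (1, 0) = 0) then 1 else 0))
      ≤ ∑ o : Option (ZMod 7), (Finset.univ.filter fun t => p1rep o ᵥ* xMat (u t) = 0).card := by
    calc _ ≤ ∑ i, (Finset.univ.filter fun o : Option (ZMod 7) => p1rep o ᵥ* xMat (u i) = 0).card := by
          refine Finset.sum_le_sum fun i _ => ?_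
          by_cases h0 : u i = 0
          · have hz : ∀ o : Option (ZMod 7), p1rep o ᵥ* xMat (u i) = 0 := by
              intro o; ext j; simp [h0, xMat, Matrix.vecMul, dotProduct]
            have e1 : (if u i = 0 then 1 else 0) = 1 := if_pos h0
            have e2 : (if (u i ≠ 0 ∧ u i (0, 0) * u i (1, 1) - u i (0, 1) * u i (1, 0) = 0) then 1 else 0) = 0 :=
              if_neg (fun h => h.1 h0)
            rw [e1, e2, mul_one, add_zero, Finset.filter_true_of_mem fun o _ => hz o, Finset.card_univ]
          · by_cases hd : u i (0, 0) * u i (1, 1) - u i (0, 1) * u i (1, 0) = 0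
            · simp only [h0, hd, if_false, mul_zero, zero_add, ne_eq, not_false_eq_true, true_and, if_true]
              exact one_le_card_rowVan (u i) hd
            · simp [h0, hd]
      _ = _ := by
          simp only [Finset.card_filter]
          exact Finset.sum_comm
  -- (b ≤ 8)
  set T2 := Finset.univ.filter (fun t : Fin r => u t (0, 0) * u t (1, 1) - u t (0, 1) * u t (1, 0) ≠ 0) with hT2
  have hT2le : T2.card ≤ 8 := by
    by_contra h8
    obtain ⟨S, hS, hScard⟩ := Finset.exists_subset_card_eq (show 9 ≤ T2.card by omega)
    have hcard : Fintype.card S = 9 := by rw [Fintype.card_coe, hScard]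
    let e : Fin 9 ≃ S := (Fintype.equivFinOfCardEq hcard).symm
    refine no_nine_gf7 (ι := Fin r) (by simpa using hr) β u hA (fun j => ((e j : S) : Fin r)) ?_ ?_
    · intro j j' h
      exact e.injective (Subtype.ext h)
    · intro j
      have hm := hS (e j).2
      rw [hT2, Finset.mem_filter] at hm
      exact hm.2
  -- bookkeeping
  set Z0 := Finset.univ.filter (fun t : Fin r => u t = 0) with hZ0
  set R1 := Finset.univ.filter (fun t : Fin r => u t ≠ 0 ∧ u t (0, 0) * u t (1, 1) - u t (0, 1) * u t (1, 0) = 0) with hR1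
  have hpart : ∀ A : Fin 2 × Fin 2 → ZMod 7, (if A = 0 then 1 else 0)
      + (if (A ≠ 0 ∧ A (0, 0) * A (1, 1) - A (0, 1) * A (1, 0) = 0) then 1 else 0)
      + (if A (0, 0) * A (1, 1) - A (0, 1) * A (1, 0) ≠ 0 then 1 else 0) = 1 := by
    intro A
    by_cases h0 : A = 0
    · simp [h0]
    · by_cases hd : A (0, 0) * A (1, 1) - A (0, 1) * A (1, 0) = 0 <;> simp [h0, hd]
  have hpsum := Finset.sum_congr rfl fun i (_ : i ∈ (Finset.univ : Finset (Fin r))) => hpart (u i)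
  rw [Finset.sum_add_distrib, Finset.sum_add_distrib, Finset.sum_boole, Finset.sum_boole, Finset.sum_boole] at hpsum
  simp only [Finset.sum_const, Finset.card_univ, Fintype.card_fin, smul_eq_mul, mul_one, Nat.cast_id] at hpsum
  rw [Finset.sum_add_distrib, ← Finset.mul_sum, Finset.sum_boole, Finset.sum_boole] at hL
  simp only [Nat.cast_id] at hL
  rw [← hZ0, ← hR1, ← hT2] at hpsum
  rw [← hZ0, ← hR1] at hL
  have hO : Fintype.card (Option (ZMod 7)) = 8 := rfl
  rw [hO] at hL hRsum
  omega

/-- **`3n + 2 ≤ R_𝔽₇(⟨2,2,n⟩)` for every `n ≥ 8`** (unconditional kernel bound; the printed any-field bound is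
Alekseev 2014/2015, `n ≥ 3`). -/
theorem three_mul_add_two_le_tensorRank_matMulTensor_22n_gf7 (n : ℕ) (hn : 8 ≤ n) :
    3 * n + 2 ≤ tensorRank (matMulTensor (ZMod 7) 2 2 n) := by
  have h1 := three_mul_add_one_le_tensorRank_matMulTensor_22n (ZMod 7) n (by omega)
  by_contra hlt
  obtain ⟨w, u, v, hdec⟩ := exists_triad_decomposition_tensorRank (matMulTensor (ZMod 7) 2 2 n)
  have h24 := card_le_24_gf7 n _ w u v hdec (by omega)
  omega

/-- The combined kernel floor over `𝔽₇`: `max(3n + 2, ⌈52n/17⌉) ≤ R_𝔽₇(⟨2,2,n⟩) ≤ ⌈7n/2⌉` for `n ≥ 8`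
(floor = the printed any-field / Alekseev–Nazarov values; ceiling = Hopcroft–Kerr gluing). -/
theorem tensorRank_matMulTensor_22n_gf7_window (n : ℕ) (hn : 8 ≤ n) :
    max (3 * n + 2) ((52 * n + 16) / 17) ≤ tensorRank (matMulTensor (ZMod 7) 2 2 n) ∧
      tensorRank (matMulTensor (ZMod 7) 2 2 n) ≤ (7 * n + 1) / 2 := by
  have h1 := three_mul_add_two_le_tensorRank_matMulTensor_22n_gf7 n hn
  have h2 := three_mul_sq_add_three_mul_le_tensorRank_matMulTensor_22n (ZMod 7) n
  have hq : Fintype.card (ZMod 7) = 7 := ZMod.card 7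
  rw [hq] at h2
  refine ⟨max_le h1 ?_, hopcroftKerr1971_tensorRank_matMulTensor_22n_le (K := ZMod 7) n⟩
  omega

/-- Census numerals over `𝔽₇` (the first and last cells this file adds): `26 ≤ R_𝔽₇(⟨2,2,8⟩) ≤ 28` and
`53 ≤ R_𝔽₇(⟨2,2,17⟩) ≤ 60`. -/
theorem tensorRank_matMulTensor_22n_gf7_numerals :
    tensorRank (matMulTensor (ZMod 7) 2 2 8) ∈ Set.Icc 26 28 ∧ tensorRank (matMulTensor (ZMod 7) 2 2 17) ∈ Set.Icc 53 60 := by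
  refine ⟨⟨?_, ?_⟩, ⟨?_, ?_⟩⟩
  · exact three_mul_add_two_le_tensorRank_matMulTensor_22n_gf7 8 (by norm_num)
  · exact hopcroftKerr1971_tensorRank_matMulTensor_22n_le (K := ZMod 7) 8
  · exact three_mul_add_two_le_tensorRank_matMulTensor_22n_gf7 17 (by norm_num)
  · exact hopcroftKerr1971_tensorRank_matMulTensor_22n_le (K := ZMod 7) 17

/-- The `⟨2,2,n⟩ / ⟨2,n,2⟩ / ⟨n,2,2⟩` orientations over `𝔽₇`: `3n + 2 ≤ R` for `n ≥ 8` in all three. -/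
theorem three_mul_add_two_le_tensorRank_matMulTensor_2n2_n22_gf7 (n : ℕ) (hn : 8 ≤ n) :
    3 * n + 2 ≤ tensorRank (matMulTensor (ZMod 7) 2 n 2) ∧ 3 * n + 2 ≤ tensorRank (matMulTensor (ZMod 7) n 2 2) := by
  constructor
  · rw [(Blaser2013_lemma55 (ZMod 7) 2 n 2).1]; exact three_mul_add_two_le_tensorRank_matMulTensor_22n_gf7 n hn
  · rw [(Blaser2013_lemma55 (ZMod 7) n 2 2).2.1]; exact three_mul_add_two_le_tensorRank_matMulTensor_22n_gf7 n hn

end GF7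

end Summit.MatrixMultiplication.OmegaCensus.SmallFormats
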